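import Summits.Ventures.Crystal3D.LocalLP.Induction
import Summits.Ventures.Crystal3D.LocalLP.ContactBridge
import Summits.Ventures.Crystal3D.Inequalities.ExposedAreaDeficit
import Literature.Geometry.DiscreteGeometry.SolidAngleFraction
import HarnessLib

/-!
# The surface bound from named geometric inputs: composition of the whole chain

HONEST FRAMING. Part of the venture `Summits/Ventures/Crystal3D` (cell `pub-crystal3d`). This file
is the top of the "local inequalities + LP certificate ⇒ theorem" chain for the contact number of
unit sphere packings in `ℝ³`. It DEFINES the exposed directions of a ball and their normalised
area, STATES the three packing-level geometric inputs as named propositions (hypotheses — NOT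
proved here, NOT asserted), and PROVES that together with a certified per-type table, the
vertex-removal induction (`LocalLP/Induction.lean`) and base cases they imply the surface bound
`C(x) < 6N - γ N^{2/3}` for every packing of every `N ≥ 2` balls (the unfolded form of
`Statement.SurfaceBound γ`). The trust base of any instance is therefore exactly: the three named
inputs (each a consequence of published theorems — Lévy–Schmidt spherical isoperimetry, the
isoperimetric inequality of `ℝ³` with a cell/density bound, and kissing saturation — whose
derivations are the cell's `Inequalities/` files and Literature facts), plus kernel-checked
arithmetic. No crystallization statement is claimed.

## Definitions (diameter-`1` balls, contact at distance `1`; probing radius `r`, e.g. `r = 1`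
## is Bezdek–Reid's radius-`2` sphere around radius-`1` balls)

* `exposedCap x r i` — the EXPOSED DIRECTIONS of ball `i`: unit vectors `u` such that the point
  `x i + r • u` of the probing sphere lies in no OPEN ball of radius `r` about another centre
  (`r ≤ dist (x i + r • u) (x j)` for all `j ≠ i`), i.e. the part of the sphere `S(x i, r)` on the
  boundary of the union `⋃ B(x j, r)`.
* `exposedFraction x r i ∈ [0, 1]` — its normalised area: the unit-ball volume fraction of the
  cone it spans (`Literature.Geometry.DiscreteGeometry.ballFraction`, Hales DSP §3.2), i.e. solid
  angle `/ 4π`. This is literally `sphereFraction (exposedCap x r i)` of the cell's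
  `Literature/Geometry/DiscreteGeometry/SphericalIsoperimetric.lean` (same `rayCone` body), so the
  Lévy–Schmidt fact typed there applies verbatim; no surface-measure normalisation enters.

## Named inputs (hypotheses of the composition; the cell proves/cites them separately)

* `LevyCapInput r F` — for every packing and every ball with `k ≤ 11` contacts,
  `exposedFraction ≤ F k` (Bezdek–Reid's cap-covering step sharpened by Lévy–Schmidt: the `k`
  contact directions carry disjoint caps, and the neighbourhood of their union is at least that
  of a cap of the same area; `F` is the resulting explicit table, in sphere fractions).
* `SaturationInput r` — a ball with `12` contacts has no exposed directions of positive measure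
  at radius `r` (kissing saturation; Hales 2012 / Bezdek–Reid Thm 4 for `r` below the `2.52/2`
  gap).
* `IsoInput r s` — for every packing of `N` balls, `∑ᵢ exposedFraction ≥ s · N^{2/3}`
  (isoperimetric inequality for the union of the `r`-balls + a volume lower bound `N · v` for it:
  `s = (36π)^{1/3} v^{2/3} / (4π r²)`).

## Proved

* `surfaceLP_of_inputs` — the LP step on a packing all of whose balls have `> k₀` contacts:
  `C(x) ≤ 6N - (s / 2ρ) N^{2/3}` whenever `F k ≤ ρ (12 - k)` for `k₀ < k ≤ 11` (via the cell's
  summation lemma `Inequalities.contacts_le_of_exposed`, seat p2).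
* `surfaceBound_of_inputs` — THE COMPOSITION: inputs + table + `γ < s / 2ρ` + base cases
  (`2 ≤ N ≤ N₁`) + the step condition (`N ≥ N₁`) ⇒ `∀ N ≥ 2, ∀ packing, C < 6N - γ N^{2/3}`.
* Base-case helpers: `rpow_two_thirds_le_of_sq_le_cube` (`t² ≤ q³ ⇒ t^{2/3} ≤ q`) and
  `base_case_of_choose_two` (`N(N-1)/2 < 6N - γ q`, `N^{2/3} ≤ q` ⇒ the bound at `N`), so that a
  finite base table is discharged by `norm_num`.

References: K. Bezdek, S. Reid, J. Geom. 104 (2013) 57–83, §2; T. Figiel, J. Lindenstrauss,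
V. D. Milman, Acta Math. 139 (1977), Thm 2.1 (Lévy–Schmidt); H. Federer, *Geometric Measure
Theory* (1969) 3.2.43; T. C. Hales, *Dense Sphere Packings* (2012) §3.2 (solid angle as volume
fraction).
-/

noncomputable section

open scoped BigOperators
open Finset

namespace Summit.Ventures.Crystal3D

open Literature.Geometry.DiscreteGeometry (ballFraction ballFraction_nonneg ballFraction_le_one)
open Summit.Ventures.Crystal3D.Inequalities (contacts_le_of_exposed)

variable {N : ℕ}

/-! ## Exposed directions and their normalised area -/

/-- The **exposed directions** of ball `i` at probing radius `r`: unit vectors `u` for which the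
point `x i + r • u` lies in no open ball of radius `r` about another centre. -/
def exposedCap (x : Fin N → EuclideanSpace ℝ (Fin 3)) (r : ℝ) (i : Fin N) :
    Set (EuclideanSpace ℝ (Fin 3)) :=
  {u | ‖u‖ = 1 ∧ ∀ j, j ≠ i → r ≤ dist (x i + r • u) (x j)}

/-- The **exposed fraction** of ball `i` at radius `r`: the normalised area (solid angle `/ 4π`)
of its exposed directions, as the unit-ball volume fraction of the cone of non-zero vectors whose
direction is exposed (`ballFraction`; equal by `rfl` to `sphereFraction (exposedCap x r i)` of
`Literature/Geometry/DiscreteGeometry/SphericalIsoperimetric.lean`). -/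
def exposedFraction (x : Fin N → EuclideanSpace ℝ (Fin 3)) (r : ℝ) (i : Fin N) : ℝ :=
  ballFraction (0 : EuclideanSpace ℝ (Fin 3)) {v | v ≠ 0 ∧ ‖v‖⁻¹ • v ∈ exposedCap x r i}

/-- An exposed fraction is non-negative. -/
theorem exposedFraction_nonneg (x : Fin N → EuclideanSpace ℝ (Fin 3)) (r : ℝ) (i : Fin N) :
    0 ≤ exposedFraction x r i :=
  ballFraction_nonneg _ _

/-- An exposed fraction is at most `1`. -/
theorem exposedFraction_le_one (x : Fin N → EuclideanSpace ℝ (Fin 3)) (r : ℝ) (i : Fin N) :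
    exposedFraction x r i ≤ 1 :=
  ballFraction_le_one _ _

/-! ## The three named inputs (hypotheses; proved or cited elsewhere in the cell) -/

/-- **Input (L), cap covering / Lévy–Schmidt**: in every packing of diameter-`1` balls in `ℝ³`,
a ball with `k ≤ 11` contacts has exposed fraction at radius `r` at most `F k`. (The table `F`
is explicit — e.g. `F k = 2 g_k = fLevy2 k / 4π` of `Inequalities/ExposedAreaDeficit.lean` at
`r = 1` — and is what the Lévy–Schmidt inequality with `k` disjoint contact caps yields; this
Prop is the packing-level STATEMENT, a hypothesis here.) -/
def LevyCapInput (r : ℝ) (F : ℕ → ℝ) : Prop :=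
  ∀ (N : ℕ) (x : Fin N → EuclideanSpace ℝ (Fin 3)), IsUnitPacking x → ∀ i : Fin N,
    coordination x i ≤ 11 → exposedFraction x r i ≤ F (coordination x i)

/-- **Input (K), kissing saturation**: in every packing, a ball with `12` contacts has exposed
fraction `0` at radius `r` (every direction of its `r`-sphere is within `r` of one of the twelve
neighbours; Hales 2012 / Bezdek–Reid Thm 4 for `r` below half the `2.52` gap). A hypothesis
here. -/
def SaturationInput (r : ℝ) : Prop :=
  ∀ (N : ℕ) (x : Fin N → EuclideanSpace ℝ (Fin 3)), IsUnitPacking x → ∀ i : Fin N,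
    coordination x i = 12 → exposedFraction x r i = 0

/-- **Input (I), isoperimetry**: in every packing of `N` diameter-`1` balls in `ℝ³` the exposed
fractions at radius `r` sum to at least `s · N^{2/3}` (isoperimetric inequality for the union of
the `r`-balls, whose volume is at least `N` times a cell volume; `s` collects the constants).
A hypothesis here. -/
def IsoInput (r s : ℝ) : Prop :=
  ∀ (N : ℕ) (x : Fin N → EuclideanSpace ℝ (Fin 3)), IsUnitPacking x →
    s * (N : ℝ) ^ ((2 : ℝ) / 3) ≤ ∑ i, exposedFraction x r i

/-! ## The LP step on reduced packings -/

/-- **LP step.** Under the three inputs and a table bound `F k ≤ ρ (12 - k)` for `k₀ < k ≤ 11`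
(`ρ > 0`), every packing all of whose balls have more than `k₀` contacts satisfies
`C(x) ≤ 6N - (s / 2ρ) · N^{2/3}` — the cell's summation lemma `contacts_le_of_exposed` applied
with `e i = exposedFraction x r i`, `k i = coordination x i`. -/
theorem surfaceLP_of_inputs {r s ρ : ℝ} {F : ℕ → ℝ} {k₀ : ℕ} (hcap : LevyCapInput r F)
    (hsat : SaturationInput r) (hiso : IsoInput r s) (hρ : 0 < ρ)
    (hF : ∀ k : ℕ, k₀ < k → k ≤ 11 → F k ≤ ρ * (12 - (k : ℝ)))
    {N : ℕ} (x : Fin N → EuclideanSpace ℝ (Fin 3)) (hx : IsUnitPacking x)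
    (hk₀ : ∀ i, k₀ < coordination x i) :
    (numContacts x : ℝ) ≤ 6 * N - s / (2 * ρ) * (N : ℝ) ^ ((2 : ℝ) / 3) := by
  classical
  -- the effective table: `0` at `12` and below `k₀` (no such balls occur)
  set f : ℕ → ℝ := fun m => if m = 12 then 0 else if k₀ < m then F m else 0 with hf
  have h := contacts_le_of_exposed (C := numContacts x) (fun i => coordination x i)
    (fun i => exposedFraction x r i) f (ρ := ρ) (S := s * (N : ℝ) ^ ((2 : ℝ) / 3)) hρ
    (fun i => Nat.succ_le_of_lt (lt_of_le_of_lt (Nat.zero_le _) (hk₀ i)))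
    (fun i => coordination_le_twelve hx i)
    (by simp [hf])
    (by
      intro m hm1 hm11
      have hm12 : m ≠ 12 := by omega
      have hρm : 0 ≤ ρ * (12 - (m : ℝ)) := by
        have : (m : ℝ) ≤ 11 := by exact_mod_cast hm11
        nlinarith
      by_cases hkm : k₀ < m
      · simp only [hf, hm12, if_false, hkm, if_true]; exact hF m hkm hm11
      · simp only [hf, hm12, if_false, hkm]; exact hρm)
    (by
      intro i
      by_cases h12 : coordination x i = 12
      · simp only [hf, h12, if_true]; exact (hsat N x hx i h12).le
      · have h11 : coordination x i ≤ 11 := by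
          have := coordination_le_twelve hx i; omega
        simp only [hf, h12, if_false, hk₀ i, if_true]
        exact hcap N x hx i h11)
    (hiso N x hx)
    (sum_coordination_eq x).symm
  have hrew : s * (N : ℝ) ^ ((2 : ℝ) / 3) / (2 * ρ) = s / (2 * ρ) * (N : ℝ) ^ ((2 : ℝ) / 3) := by
    ring
  rw [hrew] at h
  exact h

/-! ## Base-case helpers -/

/-- `t² ≤ q³` (with `t, q ≥ 0`) gives `t^{2/3} ≤ q` — rational certificates for `N^{2/3}`. -/
theorem rpow_two_thirds_le_of_sq_le_cube {t q : ℝ} (ht : 0 ≤ t) (hq : 0 ≤ q)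
    (h : t ^ 2 ≤ q ^ 3) : t ^ ((2 : ℝ) / 3) ≤ q := by
  have h1 : t ^ ((2 : ℝ) / 3) = (t ^ 2) ^ ((1 : ℝ) / 3) := by
    rw [← Real.rpow_natCast, ← Real.rpow_mul ht]; norm_num
  have h2 : q = (q ^ 3) ^ ((1 : ℝ) / 3) := by
    rw [← Real.rpow_natCast, ← Real.rpow_mul hq]; norm_num
  rw [h1, h2]
  exact Real.rpow_le_rpow (by positivity) h (by norm_num)

/-- **Base case from the trivial bound**: if `N^{2/3} ≤ q` and `N(N-1)/2 < 6N - γ q` with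
`γ ≥ 0`, then every configuration of `N` balls has `C < 6N - γ N^{2/3}`. -/
theorem base_case_of_choose_two {γ q : ℝ} {N : ℕ} (hγ : 0 ≤ γ)
    (hq : (N : ℝ) ^ ((2 : ℝ) / 3) ≤ q) (h : (N : ℝ) * ((N : ℝ) - 1) / 2 < 6 * N - γ * q)
    (x : Fin N → EuclideanSpace ℝ (Fin 3)) :
    (numContacts x : ℝ) < 6 * N - γ * (N : ℝ) ^ ((2 : ℝ) / 3) := by
  have h1 := numContacts_le_choose_two x
  have h2 : γ * (N : ℝ) ^ ((2 : ℝ) / 3) ≤ γ * q := mul_le_mul_of_nonneg_left hq hγ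
  linarith

/-! ## The composition -/

/-- **Surface bound from the named inputs.** Let `(L)`, `(K)`, `(I)` hold at radius `r` with
table `F` and constant `s`; let `ρ > 0` dominate the table (`F k ≤ ρ(12 - k)` for
`k₀ < k ≤ 11`) and `0 ≤ γ < s / 2ρ`; let the bound hold for `2 ≤ N ≤ N₁` (base cases, `N₁ ≥ 2`)
and let `γ ((N+1)^{2/3} - N^{2/3}) ≤ 6 - k₀` for `N ≥ N₁` (step condition; see
`step_of_threshold`). Then EVERY packing of every `N ≥ 2` diameter-`1` balls in `ℝ³` satisfies
`C(x) < 6N - γ N^{2/3}`. -/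
theorem surfaceBound_of_inputs {r s ρ γ : ℝ} {F : ℕ → ℝ} {k₀ N₁ : ℕ}
    (hcap : LevyCapInput r F) (hsat : SaturationInput r) (hiso : IsoInput r s) (hρ : 0 < ρ)
    (hF : ∀ k : ℕ, k₀ < k → k ≤ 11 → F k ≤ ρ * (12 - (k : ℝ))) (hγ : γ < s / (2 * ρ))
    (hN₁ : 2 ≤ N₁)
    (hbase : ∀ N : ℕ, 2 ≤ N → N ≤ N₁ → ∀ x : Fin N → EuclideanSpace ℝ (Fin 3),
      IsUnitPacking x → (numContacts x : ℝ) < 6 * N - γ * (N : ℝ) ^ ((2 : ℝ) / 3))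
    (hstep : ∀ N : ℕ, N₁ ≤ N →
      γ * (((N : ℝ) + 1) ^ ((2 : ℝ) / 3) - (N : ℝ) ^ ((2 : ℝ) / 3)) ≤ 6 - (k₀ : ℝ)) :
    ∀ N : ℕ, 2 ≤ N → ∀ x : Fin N → EuclideanSpace ℝ (Fin 3), IsUnitPacking x →
      (numContacts x : ℝ) < 6 * N - γ * (N : ℝ) ^ ((2 : ℝ) / 3) := by
  refine surfaceBound_of_reduction hN₁ hbase hstep ?_
  intro N hN x hx hk₀
  have hLP := surfaceLP_of_inputs hcap hsat hiso hρ hF x hx hk₀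
  have hNpos : (0 : ℝ) < N := by exact_mod_cast (lt_of_lt_of_le (by omega : 0 < N₁) hN.le)
  have hpow : 0 < (N : ℝ) ^ ((2 : ℝ) / 3) := Real.rpow_pos_of_pos hNpos _
  have hγ' : γ * (N : ℝ) ^ ((2 : ℝ) / 3) < s / (2 * ρ) * (N : ℝ) ^ ((2 : ℝ) / 3) :=
    mul_lt_mul_of_pos_right hγ hpow
  linarith

end Summit.Ventures.Crystal3D

end
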